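import Summits.KontsevichZagierPeriods.KontsevichZagierPeriods.Theorems.StandardPartsSpAeCongruence
import Summits.KontsevichZagierPeriods.KontsevichZagierPeriods.Theorems.StandardPartsSpArcClosureStubArcRigidity
import Summits.KontsevichZagierPeriods.KontsevichZagierPeriods.Theorems.StandardPartsSpArcClosureStubEndpointAeEq

/-!
# Route StandardParts — crux `SpArcClosure` (stmt-KontsevichZagierPeriods-3153): closedness of
KZ-equivalence at `L¹`-endpoints of `ℚ`-semialgebraic arcs of integral representations

Problem `KontsevichZagierPeriods`, route `StandardParts`, crux item stmt-KontsevichZagierPeriods-3153,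
decl `Summit.KontsevichZagierPeriods.KontsevichZagierPeriods.Theses.StandardParts.SpArcClosure`:
for arcs `R : ℝ → KZ.IntegralRep n`, `R' : ℝ → KZ.IntegralRep m` whose total domains
`{(x,t) | t ∈ (0,1), x ∈ dom R_t}` and total integrands are `ℚ`-semialgebraic, if `R_t ~ R'_t`
for every `t ∈ (0,1)` and the extended integrands converge in `L¹` to those of `r₀`, `r₀'` as
`t → 0⁺`, then `r₀ ~ r₀'`.

This file is the sorry-free form of the registered skeleton `Cruxes/SpArcClosure/Lines/birth.lean`
(line `registered`); its two stubs have landed as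
`Summit.KontsevichZagierPeriods.StandardParts.stub_arcRigidity`
(`Theorems/StandardPartsSpArcClosureStubArcRigidity.lean`: an arc of representations with
`ℚ`-semialgebraic total data is CONSTANT on some `(0, ε)` — every fibre of a `KZ.IntegralRep`-valued
arc is `ℚ`-semialgebraic, there are countably many such sets, the level sets and the jump set of the
family are semialgebraic subsets of the line by Tarski–Seidenberg, so the jump set is countable,
hence finite near `0⁺`) and `Summit.KontsevichZagierPeriods.StandardParts.stub_endpointAeEq`
(`Theorems/StandardPartsSpArcClosureStubEndpointAeEq.lean`: the `L¹`-endpoint of a constant germ is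
attained almost everywhere). The composition is the registered one: rigidity for `R` and `R'`, one
common small parameter `t₀`, the two a.e. identities at `t₀`, the landed support item
`SpAeCongruence` (`SpAeCongruence_proof`, Theorems/StandardPartsSpAeCongruence.lean) and transitivity
of `KZ.Equivalent`: `r₀ ~ R t₀ ~ R' t₀ ~ r₀'`.

As recorded by the route-review refuters on the item (2026-08-15) and in the skeleton's header, the
crux AS TYPED carries no standard-part content: `KZ.IntegralRep`-valued semialgebraic arcs are
eventually constant, so the statement collapses to `SpAeCongruence` plus rigidity. The route's
intended mechanism (standard parts of RAW semialgebraic families) is planner business.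

Sources: M. Kontsevich, D. Zagier, *Periods* (2001), §1.2; L. van den Dries, *Tame Topology and
O-minimal Structures* (1998), Ch. 1 (3.2)–(3.3); J. Bochnak, M. Coste, M.-F. Roy, *Real Algebraic
Geometry* (1998), Thm. 2.2.1.
-/

noncomputable section

open MeasureTheory Set Filter
open scoped Topology

namespace Summit.KontsevichZagierPeriods.StandardParts

open Literature.NumberTheory.Transcendental Literature.NumberTheory.Transcendental.KZ
open Literature.ModelTheory.ExponentialFields (IsSemialgebraic)
open Summit.KontsevichZagierPeriods.KontsevichZagierPeriods.Theses.StandardParts (SpArcClosure)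

/-- **Crux `SpArcClosure` (stmt-KontsevichZagierPeriods-3153), proved.** KZ-equivalence of integral
representations is closed at `L¹`-endpoints of `ℚ`-semialgebraic arcs `R : ℝ → KZ.IntegralRep n`,
`R' : ℝ → KZ.IntegralRep m` that are fibrewise equivalent on `(0,1)`. The `suffices` line is the
registered implication `<stub_arcRigidity> → <stub_endpointAeEq> → SpArcClosure`, applied to the two
landed stubs by name; its proof: rigidity for `R` and for `R'` gives `ε, ε'`; at
`t₀ = min ε ε' / 2` the two `L¹`-endpoints are attained a.e.; `SpAeCongruence_proof` turns the a.e.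
identities into `R t₀ ~ r₀`, `R' t₀ ~ r₀'`; the fibrewise hypothesis gives `R t₀ ~ R' t₀`; conclude
by `KZ.Equivalent.symm/trans`. [Kontsevich–Zagier 2001, §1.2] [cite: KontsevichZagier2001, §1.2] -/
theorem SpArcClosure_of : SpArcClosure := by
  suffices key :
      (∀ ⦃n : ℕ⦄ (D : ℝ → Set (Fin n → ℝ)) (f : ℝ → (Fin n → ℝ) → ℝ),
        Literature.ModelTheory.ExponentialFields.IsSemialgebraic ℚ
        {z : Fin (n + 1) → ℝ | z (Fin.last n) ∈ Set.Ioo (0:ℝ) 1 ∧ Fin.init z ∈ D (z (Fin.last n))} →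
        Literature.NumberTheory.Transcendental.IsSemialgebraicFunOn ℚ
        {z : Fin (n + 1) → ℝ | z (Fin.last n) ∈ Set.Ioo (0:ℝ) 1 ∧ Fin.init z ∈ D (z (Fin.last n))}
        (fun z => f (z (Fin.last n)) (Fin.init z)) →
        (∀ t ∈ Set.Ioo (0:ℝ) 1, Literature.ModelTheory.ExponentialFields.IsSemialgebraic ℚ (D t)) →
        (∀ t ∈ Set.Ioo (0:ℝ) 1, Literature.NumberTheory.Transcendental.IsSemialgebraicFunOn ℚ (D t) (f t)) →
        ∃ ε ∈ Set.Ioo (0:ℝ) 1, ∀ s ∈ Set.Ioo (0:ℝ) ε, ∀ t ∈ Set.Ioo (0:ℝ) ε,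
        D s = D t ∧ Set.EqOn (f s) (f t) (D t)) →
      (∀ ⦃n : ℕ⦄ (R : ℝ → Literature.NumberTheory.Transcendental.KZ.IntegralRep n)
        (r₀ : Literature.NumberTheory.Transcendental.KZ.IntegralRep n) ⦃ε : ℝ⦄, ε ∈ Set.Ioo (0:ℝ) 1 →
        (∀ s ∈ Set.Ioo (0:ℝ) ε, ∀ t ∈ Set.Ioo (0:ℝ) ε,
        (R s).domain = (R t).domain ∧ Set.EqOn (R s).integrand (R t).integrand (R t).domain) →
        Filter.Tendsto (fun t : ℝ => ∫ x, |(R t).domain.indicator (R t).integrand x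
        - r₀.domain.indicator r₀.integrand x|) (𝓝[>] (0:ℝ)) (𝓝 0) →
        ∀ t ∈ Set.Ioo (0:ℝ) ε,
        (R t).domain.indicator (R t).integrand =ᵐ[MeasureTheory.volume] r₀.domain.indicator r₀.integrand) →
      SpArcClosure from key stub_arcRigidity stub_endpointAeEq
  intro h₁ h₂ n m R R' r₀ r₀' hD hF hD' hF' heq hL hL'
  -- rigidity of the two arcs
  obtain ⟨ε, hε, hR⟩ := h₁ (fun t => (R t).domain) (fun t => (R t).integrand) hD hF
    (fun t _ => (R t).isSemialgebraic_domain) (fun t _ => (R t).isSemialgebraicFunOn_integrand)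
  obtain ⟨ε', hε', hR'⟩ := h₁ (fun t => (R' t).domain) (fun t => (R' t).integrand) hD' hF'
    (fun t _ => (R' t).isSemialgebraic_domain) (fun t _ => (R' t).isSemialgebraicFunOn_integrand)
  -- one common small parameter
  obtain ⟨t₀, ht₀ε, ht₀ε', ht₀1⟩ :
      ∃ t₀ : ℝ, t₀ ∈ Set.Ioo (0:ℝ) ε ∧ t₀ ∈ Set.Ioo (0:ℝ) ε' ∧ t₀ ∈ Set.Ioo (0:ℝ) 1 := by
    have hpos : 0 < min ε ε' := lt_min hε.1 hε'.1
    have h1 : min ε ε' / 2 < ε := (half_lt_self hpos).trans_le (min_le_left _ _)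
    have h2 : min ε ε' / 2 < ε' := (half_lt_self hpos).trans_le (min_le_right _ _)
    exact ⟨min ε ε' / 2, ⟨half_pos hpos, h1⟩, ⟨half_pos hpos, h2⟩, ⟨half_pos hpos, h1.trans hε.2⟩⟩
  -- the endpoints are attained a.e. by the constant germs
  have ha : (R t₀).domain.indicator (R t₀).integrand =ᵐ[volume]
      r₀.domain.indicator r₀.integrand := h₂ R r₀ hε hR hL t₀ ht₀ε
  have hb : (R' t₀).domain.indicator (R' t₀).integrand =ᵐ[volume]
      r₀'.domain.indicator r₀'.integrand := h₂ R' r₀' hε' hR' hL' t₀ ht₀ε'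
  -- a.e.-congruence (landed support item SpAeCongruence) and transitivity of KZ-equivalence
  have e₁ : KZ.Equivalent (R t₀) r₀ := SpAeCongruence_proof (R t₀) r₀ ha
  have e₂ : KZ.Equivalent (R t₀) (R' t₀) := heq t₀ ht₀1
  have e₃ : KZ.Equivalent (R' t₀) r₀' := SpAeCongruence_proof (R' t₀) r₀' hb
  exact (e₁.symm.trans e₂).trans e₃

/-- The crux decl by its route-level name: `SpArcClosure` holds (alias of `SpArcClosure_of` with
the type spelled as the fully qualified route decl, for `ledger workitem release --by`).
[Kontsevich–Zagier 2001, §1.2] [cite: KontsevichZagier2001, §1.2] -/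
theorem SpArcClosure_proof :
    Summit.KontsevichZagierPeriods.KontsevichZagierPeriods.Theses.StandardParts.SpArcClosure :=
  SpArcClosure_of

end Summit.KontsevichZagierPeriods.StandardParts
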